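import Mathlib

/-!
# SoloBlindSplittingChain — splitting descent along a whole weight chain (m-fold dévissage)

Solo-blind programme on `Summit.KontsevichZagierPeriods` (Kontsevich–Zagier period conjecture in the
effective Nori form), session s76.  Kernel form of the FULL INDUCTION of PROPOSITION W′ (iii) ⟹ (ii)
(`paper/inj-sectors.md` §13, claim C674; induction step = `SoloBlindSplittingDevissage`, s71):
over a Hodge-conjecture sector, effective fullness of Nori motives ("Inj") is equivalent to
SPLITTING DESCENT, and splitting descent for objects with ANY number of weights follows from
splitting descent for TWO-WEIGHT objects together with the uniqueness of complements supplied by the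
strictness of weights (`SoloBlindComplementUnique`).

The shadow.  The faithful exact functor `Φ : MM^eff → MM` is modelled by restriction of scalars
along an algebra `A → B`: an effective object is a `B`-module `E`, effective subobjects are
`B`-submodules, subobjects downstairs are `A`-submodules (`Submodule.restrictScalars`).  The weight
filtration is a chain of `B`-submodules `W 0 ≤ W 1 ≤ W 2 ≤ ⋯ ≤ W (m+1) = ⊤` (`W 0` = the base,
`⊥` in the application; `W 1` = the lowest pure piece).  Quotients `E ⧸ P` are avoided by working
RELATIVE TO A BASE `P`: "`N` is an `A`-complement of `Q` over `P`" means
`P ≤ N`, `N ⊓ Q = P`, `N ⊔ Q = ⊤` (resp. `= T` inside `T`).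

The induction (`exists_relCompl_of_chain`).  Stage `j` has base `P` = any effective complement of
`W 1` inside `W (j+1)` over `W 0` (these are exactly the bases produced by the earlier stages; then
`W (j+1) ⧸ P ≅ W 1 ⧸ W 0` is the lowest pure piece and `W (j+2) ⧸ P` is a TWO-weight object).
Hypotheses, for every stage `j < m` and every such `P`: (U) (only for `j + 1 < m`, i.e. every stage
but the last) `A`-complements of `W (j+1)` inside `W (j+2)` over `P` are unique (in the motive:
`Hom(gr_{j+2}, W 1) = 0` by strictness of weights, turned into uniqueness by the torsor theorem of
`SoloBlindComplementUnique` / `SoloBlindSplittingDevissage`); (D) two-weight splitting descent for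
`W (j+2) ⧸ P`.  Conclusion: splitting descent for `E` itself —
an `A`-complement of `W 1` over `W 0` in `E` yields a `B`-complement.  Proof: downward induction on
the stage; the step is the five-step diagram chase of `SoloBlindSplittingDevissage.exists_compl_of_two_step`
in relative form (modular law twice); at the last stage `j + 1 = m` the effective complement produced
by (D) is already the answer because `W (m+1) = ⊤`.  For `m = 2` (`⊥ ≤ Wa ≤ Wb ≤ ⊤`) the hypotheses
are literally those of `exists_compl_of_two_step` ((U) at `j = 0`; (D) at `j = 0` = (D1), at
`j = 1` = (D3)); for `m = 1` the statement is tautological, as (iii) ⟹ (ii) is for two weights.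

Main results (`A → B` an algebra, `E` a `B`-module with compatible `A`-action):
* `inf_restrictScalars_relCompl` — relative modular-law step;
* `exists_relCompl_of_chain` — the m-fold dévissage over an arbitrary base `W 0`;
* `exists_compl_of_chain` — the same with base `⊥`, in the shape of
  `SoloBlindSplittingDevissage.exists_compl_of_two_step` (which is the case `m = 1` up to phrasing).
Complete proofs; no axioms beyond the standard three.
-/

namespace Summit.KontsevichZagierPeriods.KontsevichZagierPeriods.Theorems

open Submodule

universe u v w

variable {A : Type u} {B : Type v} {E : Type w} [CommRing A] [Ring B] [Algebra A B]
  [AddCommGroup E] [Module A E] [Module B E] [IsScalarTower A B E]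

/-- Relative modular-law step: if `N` is an `A`-complement of `Q` over the base `P` in `E`
(`P ≤ N`, `N ⊓ Q = P`, `N ⊔ Q = ⊤`) and `P ≤ Q ≤ T`, then `N ⊓ T` is an `A`-complement of `Q` over
`P` inside `T`. -/
theorem inf_restrictScalars_relCompl {P Q T : Submodule B E} (hPQ : P ≤ Q) (hQT : Q ≤ T)
    {N : Submodule A E} (hPN : P.restrictScalars A ≤ N)
    (hNinf : N ⊓ Q.restrictScalars A = P.restrictScalars A)
    (hNsup : N ⊔ Q.restrictScalars A = ⊤) :
    P.restrictScalars A ≤ N ⊓ T.restrictScalars A ∧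
      (N ⊓ T.restrictScalars A) ⊓ Q.restrictScalars A = P.restrictScalars A ∧
        (N ⊓ T.restrictScalars A) ⊔ Q.restrictScalars A = T.restrictScalars A := by
  have hQT' : Q.restrictScalars A ≤ T.restrictScalars A := (restrictScalars_le A).2 hQT
  have hPT' : P.restrictScalars A ≤ T.restrictScalars A := (restrictScalars_le A).2 (hPQ.trans hQT)
  refine ⟨le_inf hPN hPT', ?_, ?_⟩
  · rw [inf_assoc, inf_eq_right.2 hQT', hNinf]
  · have hmod := sup_inf_assoc_of_le N hQT'
    -- hmod : (Q' ⊔ N) ⊓ T' = Q' ⊔ N ⊓ T'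
    rw [sup_comm, ← hmod, sup_comm, hNsup, top_inf_eq]

/-- **Splitting descent along a weight chain (m-fold dévissage), relative form.**
`W 0 ≤ W 1 ≤ ⋯ ≤ W (m+1) = ⊤` is a chain of `B`-submodules of `E`.  Hypotheses, for every stage
`j < m` and every `B`-submodule `P` which is a complement of `W 1` inside `W (j+1)` over `W 0`
(`W 0 ≤ P ≤ W (j+1)`, `P ⊓ W 1 = W 0`, `P ⊔ W 1 = W (j+1)`):
(U) (stages `j + 1 < m` only) any two `A`-complements of `W (j+1)` inside `W (j+2)` over `P` coincide;
(D) if `W (j+1)` has an `A`-complement inside `W (j+2)` over `P` then it has a `B`-complement inside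
`W (j+2)` over `P`.
Conclusion: if `W 1` has an `A`-complement in `E` over `W 0` then it has a `B`-complement in `E`
over `W 0`. -/
theorem exists_relCompl_of_chain (W : ℕ → Submodule B E) (hW : ∀ j, W j ≤ W (j + 1)) (m : ℕ)
    (htop : W (m + 1) = ⊤)
    (huniq : ∀ j, j + 1 < m → ∀ P : Submodule B E, W 0 ≤ P → P ≤ W (j + 1) → P ⊓ W 1 = W 0 →
      P ⊔ W 1 = W (j + 1) → ∀ N N' : Submodule A E,
      P.restrictScalars A ≤ N → N ⊓ (W (j + 1)).restrictScalars A = P.restrictScalars A →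
        N ⊔ (W (j + 1)).restrictScalars A = (W (j + 2)).restrictScalars A →
      P.restrictScalars A ≤ N' → N' ⊓ (W (j + 1)).restrictScalars A = P.restrictScalars A →
        N' ⊔ (W (j + 1)).restrictScalars A = (W (j + 2)).restrictScalars A → N = N')
    (hD : ∀ j, j < m → ∀ P : Submodule B E, W 0 ≤ P → P ≤ W (j + 1) → P ⊓ W 1 = W 0 →
      P ⊔ W 1 = W (j + 1) →
      (∃ N : Submodule A E, P.restrictScalars A ≤ N ∧
        N ⊓ (W (j + 1)).restrictScalars A = P.restrictScalars A ∧
          N ⊔ (W (j + 1)).restrictScalars A = (W (j + 2)).restrictScalars A) →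
      ∃ R : Submodule B E, P ≤ R ∧ R ⊓ W (j + 1) = P ∧ R ⊔ W (j + 1) = W (j + 2))
    (hN : ∃ N : Submodule A E, (W 0).restrictScalars A ≤ N ∧
      N ⊓ (W 1).restrictScalars A = (W 0).restrictScalars A ∧
        N ⊔ (W 1).restrictScalars A = ⊤) :
    ∃ R : Submodule B E, W 0 ≤ R ∧ R ⊓ W 1 = W 0 ∧ R ⊔ W 1 = ⊤ := by
  have hmono : Monotone W := monotone_nat_of_le_succ hW
  -- Φ j = splitting descent at stage j (base P admissible at stage j, lowest piece W (j+1), top ⊤);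
  -- proved for all j ≤ m by downward induction, packaged as an induction on k with j + k = m.
  have key : ∀ k j : ℕ, j + k = m → ∀ P : Submodule B E, W 0 ≤ P → P ≤ W (j + 1) →
      P ⊓ W 1 = W 0 → P ⊔ W 1 = W (j + 1) → ∀ N : Submodule A E, P.restrictScalars A ≤ N →
      N ⊓ (W (j + 1)).restrictScalars A = P.restrictScalars A →
      N ⊔ (W (j + 1)).restrictScalars A = ⊤ →
      ∃ R : Submodule B E, P ≤ R ∧ R ⊓ W (j + 1) = P ∧ R ⊔ W (j + 1) = ⊤ := by
    intro k
    induction k with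
    | zero =>
      -- last stage: j = m, W (j+1) = ⊤; R := P works.
      intro j hj P _ _ _ _ N _ _ _
      have hjm : j = m := by simpa using hj
      subst hjm
      exact ⟨P, le_rfl, by rw [htop, inf_top_eq], by rw [htop, sup_top_eq]⟩
    | succ k ih =>
      intro j hj P hP0 hP1 hPinf hPsup N hPN hNinf hNsup
      have hjm : j < m := by omega
      have hW2 : W (j + 1) ≤ W (j + 2) := hW (j + 1)
      -- Step 1: N ⊓ W (j+2) is an A-complement of W (j+1) inside W (j+2) over P (modular law).
      obtain ⟨h1le, h1inf, h1sup⟩ :=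
        inf_restrictScalars_relCompl (A := A) hP1 hW2 hPN hNinf hNsup
      -- Step 2: two-weight descent (D) gives an effective complement S of W (j+1) in W (j+2) over P.
      obtain ⟨S, hPS, hSinf, hSsup⟩ :=
        hD j hjm P hP0 hP1 hPinf hPsup ⟨N ⊓ (W (j + 2)).restrictScalars A, h1le, h1inf, h1sup⟩
      rcases Nat.eq_zero_or_pos k with hk | hk
      · -- Last substantive stage (j + 1 = m): W (j+2) = ⊤ and S itself is the complement sought;
        -- no uniqueness is needed here (as in `exists_compl_of_two_step`).
        have htop2 : W (j + 2) = ⊤ := by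
          rw [show j + 2 = m + 1 by omega]
          exact htop
        exact ⟨S, hPS, hSinf, by rw [hSsup, htop2]⟩
      have hjm1 : j + 1 < m := by omega
      have hj1 : (j + 1) + k = m := by omega
      -- Step 3: by uniqueness (U) the two A-complements N ⊓ W (j+2) and S agree.
      have hPS' : P.restrictScalars A ≤ S.restrictScalars A := (restrictScalars_le A).2 hPS
      have hSinf' : S.restrictScalars A ⊓ (W (j + 1)).restrictScalars A = P.restrictScalars A := by
        rw [← restrictScalars_inf, hSinf]
      have hSsup' : S.restrictScalars A ⊔ (W (j + 1)).restrictScalars A =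
          (W (j + 2)).restrictScalars A := by
        rw [← restrictScalars_sup, hSsup]
      have hNS : N ⊓ (W (j + 2)).restrictScalars A = S.restrictScalars A :=
        huniq j hjm1 P hP0 hP1 hPinf hPsup _ _ h1le h1inf h1sup hPS' hSinf' hSsup'
      -- Step 4: S is an admissible base at stage j+1 and N is an A-complement of W (j+2) over S.
      have h1le1 : W 1 ≤ W (j + 1) := hmono (by omega)
      have hS0 : W 0 ≤ S := hP0.trans hPS
      have hS1 : S ≤ W (j + 2) := by
        rw [← hSsup]
        exact le_sup_left
      have hSinf1 : S ⊓ W 1 = W 0 := by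
        calc S ⊓ W 1 = S ⊓ (W (j + 1) ⊓ W 1) := by rw [inf_eq_right.2 h1le1]
          _ = (S ⊓ W (j + 1)) ⊓ W 1 := (inf_assoc _ _ _).symm
          _ = W 0 := by rw [hSinf, hPinf]
      have hSsup1 : S ⊔ W 1 = W (j + 2) := by
        calc S ⊔ W 1 = (S ⊔ P) ⊔ W 1 := by rw [sup_eq_left.2 hPS]
          _ = S ⊔ (P ⊔ W 1) := sup_assoc _ _ _
          _ = W (j + 2) := by rw [hPsup, hSsup]
      have hSN : S.restrictScalars A ≤ N := by
        rw [← hNS]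
        exact inf_le_left
      have hNsup2 : N ⊔ (W (j + 2)).restrictScalars A = ⊤ := by
        apply eq_top_iff.2
        rw [← hNsup]
        exact sup_le_sup_left ((restrictScalars_le A).2 hW2) N
      obtain ⟨R, hSR, hRinf, hRsup⟩ :=
        ih (j + 1) hj1 S hS0 hS1 hSinf1 hSsup1 N hSN hNS hNsup2
      -- Step 5: R is a B-complement of W (j+1) over P in E.
      refine ⟨R, hPS.trans hSR, ?_, ?_⟩
      · calc R ⊓ W (j + 1) = R ⊓ (W (j + 2) ⊓ W (j + 1)) := by rw [inf_eq_right.2 hW2]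
          _ = (R ⊓ W (j + 2)) ⊓ W (j + 1) := (inf_assoc _ _ _).symm
          _ = P := by rw [hRinf, hSinf]
      · calc R ⊔ W (j + 1) = (R ⊔ S) ⊔ W (j + 1) := by rw [sup_eq_left.2 hSR]
          _ = R ⊔ (S ⊔ W (j + 1)) := sup_assoc _ _ _
          _ = ⊤ := by rw [hSsup, hRsup]
  obtain ⟨N, hN0, hNinf, hNsup⟩ := hN
  exact key m 0 (by simp) (W 0) le_rfl (hW 0) (inf_eq_left.2 (hW 0)) (sup_eq_right.2 (hW 0))
    N hN0 hNinf hNsup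

/-- **Splitting descent along a weight chain (m-fold dévissage), absolute form** (base `W 0 = ⊥`):
the statement of `SoloBlindSplittingDevissage.exists_compl_of_two_step` for a weight filtration
`⊥ = W 0 ≤ W 1 ≤ ⋯ ≤ W (m+1) = ⊤` of arbitrary length (`m = 2` recovers it).  The admissible bases at
stage `j` are the effective complements `P` of the lowest piece `W 1` inside `W (j+1)`; (U) and (D) are
uniqueness of complements (stages `j + 1 < m`) and two-weight splitting descent for `W (j+2) ⧸ P`,
phrased inside `E`. -/
theorem exists_compl_of_chain (W : ℕ → Submodule B E) (hW : ∀ j, W j ≤ W (j + 1)) (h0 : W 0 = ⊥)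
    (m : ℕ) (htop : W (m + 1) = ⊤)
    (huniq : ∀ j, j + 1 < m → ∀ P : Submodule B E, P ≤ W (j + 1) → P ⊓ W 1 = ⊥ →
      P ⊔ W 1 = W (j + 1) → ∀ N N' : Submodule A E,
      P.restrictScalars A ≤ N → N ⊓ (W (j + 1)).restrictScalars A = P.restrictScalars A →
        N ⊔ (W (j + 1)).restrictScalars A = (W (j + 2)).restrictScalars A →
      P.restrictScalars A ≤ N' → N' ⊓ (W (j + 1)).restrictScalars A = P.restrictScalars A →
        N' ⊔ (W (j + 1)).restrictScalars A = (W (j + 2)).restrictScalars A → N = N')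
    (hD : ∀ j, j < m → ∀ P : Submodule B E, P ≤ W (j + 1) → P ⊓ W 1 = ⊥ →
      P ⊔ W 1 = W (j + 1) →
      (∃ N : Submodule A E, P.restrictScalars A ≤ N ∧
        N ⊓ (W (j + 1)).restrictScalars A = P.restrictScalars A ∧
          N ⊔ (W (j + 1)).restrictScalars A = (W (j + 2)).restrictScalars A) →
      ∃ R : Submodule B E, P ≤ R ∧ R ⊓ W (j + 1) = P ∧ R ⊔ W (j + 1) = W (j + 2))
    (hN : ∃ N : Submodule A E,
      N ⊓ (W 1).restrictScalars A = ⊥ ∧ N ⊔ (W 1).restrictScalars A = ⊤) :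
    ∃ R : Submodule B E, R ⊓ W 1 = ⊥ ∧ R ⊔ W 1 = ⊤ := by
  obtain ⟨N, hNinf, hNsup⟩ := hN
  have h0' : (W 0).restrictScalars A = ⊥ := by rw [h0, restrictScalars_bot]
  obtain ⟨R, -, hRinf, hRsup⟩ := exists_relCompl_of_chain (A := A) W hW m htop
    (fun j hj P _ hP1 hPinf hPsup => huniq j hj P hP1 (by rw [hPinf, h0]) hPsup)
    (fun j hj P _ hP1 hPinf hPsup => hD j hj P hP1 (by rw [hPinf, h0]) hPsup)
    ⟨N, by rw [h0']; exact bot_le, by rw [hNinf, h0'], hNsup⟩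
  exact ⟨R, by rw [hRinf, h0], hRsup⟩

end Summit.KontsevichZagierPeriods.KontsevichZagierPeriods.Theorems
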